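import Summits.HodgeConjecture.HodgeConjecture.Theorems.TropicalWeilObstructionTropicalWeilVanishingDegreeLadderFaces
import Summits.HodgeConjecture.HodgeConjecture.Theorems.TropicalWeilObstructionTropicalWeilVanishingSimplexDeterminants
import HarnessLib

/-!
# Route `TropicalWeilObstruction` (Kontsevich's tropical test — NEGATION SINK, exploration, no summit claim):
# the degree ladder of K1 — IV. the Stokes potentials of levels `3` and `2`, and canonical presentations of tuples

Negation-sink bookkeeping of the cell `pub-hodge-tropical` (seat tropical-1 gen 7); part IV of the DEGREE LADDER. Two ingredients of
the descent `24 ∣ intCoord Z` ([cite: MikhalkinZharkov2014Eigenwave, Prop. 4.3]):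

* the algebraic Stokes steps below part I's: `det3_sub_eq_sum_sign_potential3` (`det₃[y_{j+1}−y_0]_{·,123} = Σ_l (−1)^l E₃(y∘δ_l)`,
  `E₃(z) = (Σ_m z_{m,1})·det₂[(z_{j+1}−z_0)_{23}]`, alternating, `E₃(z+t) = E₃(z) + 3t₁det₂`) and `det2_sub_eq_sum_sign_potential2`
  (`det₂ = Σ_j (−1)^j E₂`, `E₂(w) = (w_{0,2}+w_{1,2})(w_{1,3}−w_{0,3})`, alternating, `E₂(w+t) = E₂(w) + 2t₂(w_{1,3}−w_{0,3})`), with the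
  vanishing of `det₂`, `E₂` on degenerate tuples;
* `exists_canonical_presentation` — a CHOICE (`Classical.epsilon`) of representatives `rep z = z∘κ_z + t_z` of the orbits of
  `m`-tuples of points of `ℤᵍ` under reordering and translation, constant on orbits, with the presentation UNIQUE on tuples of
  pairwise distinct points (hence `θ·κ_{z∘θ} = κ_z`, `t_{z∘θ} = t_z`, `κ_{z+s} = κ_z`, `t_{z+s} = t_z − s`) and degenerate tuples
  having degenerate representatives; `canonicalise` — for an integer function `F` vanishing on degenerate tuples,
  `F^c(z) = sign(κ_z)·F(rep z)` is ALTERNATING and TRANSLATION-INVARIANT.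

HONEST STATUS. Elementary algebra/combinatorics on the certificate format; decides nothing about K1 (`TropicalWeilVanishing`,
stmt-HodgeConjecture-18478, an OPEN problem) or about the Hodge conjecture. No definition (display-only notation), no named fact,
no sorry.
References: [MikhalkinZharkov2014Eigenwave] G. Mikhalkin, I. Zharkov, Tropical eigenwave and intermediate Jacobians,
LN UMI 15 (2014), Def. 4.2, Prop. 4.3, Thm. 5.4; [Zharkov2020TropicalWeil] I. Zharkov, arXiv:2002.02347, p. 2, §2.
-/

set_option linter.dupNamespace false

noncomputable section

open scoped BigOperators
open Matrix
open Literature.AlgebraicGeometry.Tropical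
open Summit.HodgeConjecture.HodgeConjecture.Theorems.TropicalHodgeBound

namespace Summit.HodgeConjecture.HodgeConjecture.Theorems.TropicalWeilVanishing.Ladder

/-! ## §0 Display-only notation (nothing is defined) -/

/-- The facet `3`-volume `det [(y_{j+1} - y_0)_{a+1}]_{j,a<3}` of four points with four coordinates. Nothing is defined. -/
local notation3 (prettyPrint := false) "𝐕⟦" y "⟧" =>
  (Matrix.det (Matrix.of fun (j : Fin 3) (a : Fin 3) => y (Fin.succ j) (Fin.succ a) - y 0 (Fin.succ a)))

/-- The `2`-volume `det [(z_{j+1} - z_0)_{a+2}]_{j,a<2}` of three points with four coordinates. Nothing is defined. -/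
local notation3 (prettyPrint := false) "𝐕₂⟦" z "⟧" =>
  (Matrix.det (Matrix.of fun (j : Fin 2) (a : Fin 2) => z (Fin.succ j) (Fin.succ (Fin.succ a)) - z 0 (Fin.succ (Fin.succ a))))

/-- The level-`3` potential `E₃(z) = (Σ_m z_{m,1}) · det [(z_{j+1} - z_0)_{a+2}]` (`6 ∫_{[z]} x₁ dx₂ ∧ dx₃`). Nothing is defined. -/
local notation3 (prettyPrint := false) "𝐄₃⟦" z "⟧" =>
  ((∑ m : Fin 3, z m (1 : Fin 4)) *
    Matrix.det (Matrix.of fun (j : Fin 2) (a : Fin 2) => z (Fin.succ j) (Fin.succ (Fin.succ a)) - z 0 (Fin.succ (Fin.succ a))))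

/-- The `1`-volume `w_{1,3} - w_{0,3}` of two points with four coordinates, as a `1 × 1` determinant. Nothing is defined. -/
local notation3 (prettyPrint := false) "𝐕₁⟦" w "⟧" =>
  (Matrix.det (Matrix.of fun (j : Fin 1) (a : Fin 1) =>
    w (Fin.succ j) (Fin.succ (Fin.succ (Fin.succ a))) - w 0 (Fin.succ (Fin.succ (Fin.succ a)))))

/-- The level-`2` potential `E₂(w) = (w_{0,2} + w_{1,2}) · (w_{1,3} - w_{0,3})` (`2 ∫_{[w]} x₂ dx₃`). Nothing is defined. -/
local notation3 (prettyPrint := false) "𝐄₂⟦" w "⟧" =>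
  ((∑ m : Fin 2, w m (2 : Fin 4)) *
    Matrix.det (Matrix.of fun (j : Fin 1) (a : Fin 1) =>
      w (Fin.succ j) (Fin.succ (Fin.succ (Fin.succ a))) - w 0 (Fin.succ (Fin.succ (Fin.succ a)))))

/-! ## §1 The Stokes steps of levels `3` and `2` -/

section Stokes3

variable {R : Type*} [CommRing R]

/-- **Exactness `dx₁₂₃ = d(x₁ dx₂₃)` on a `3`-simplex**: `det₃[(y_{j+1} − y_0)_{1,2,3}] = Σ_l (−1)^l E₃(y∘δ_l)` for four points
`y` with four coordinates. A polynomial identity. [folklore] -/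
theorem det3_sub_eq_sum_sign_potential3 (y : Fin 4 → Fin 4 → R) :
    𝐕⟦y⟧ = ∑ l : Fin 4, (-1) ^ (l : ℕ) * 𝐄₃⟦fun j => y (l.succAbove j)⟧ := by
  simp only [Matrix.det_fin_three, Matrix.det_fin_two, Fin.sum_univ_succ, Fin.sum_univ_zero, Matrix.of_apply,
    Fin.succAbove]
  simp
  ring

/-- `E₃` is alternating in the three points. [folklore] -/
theorem potential3_comp_perm (z : Fin 3 → Fin 4 → R) (κ : Equiv.Perm (Fin 3)) :
    𝐄₃⟦fun j => z (κ j)⟧ = ((Equiv.Perm.sign κ : ℤˣ) : ℤ) * 𝐄₃⟦z⟧ := by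
  have hsum : ∑ m : Fin 3, z (κ m) (1 : Fin 4) = ∑ m : Fin 3, z m 1 := Equiv.sum_comp κ (fun m => z m 1)
  have hdet := det_sub_perm (fun (k : Fin 3) (a : Fin 2) => z k a.succ.succ) κ
  have e1 : (Matrix.of fun (j : Fin 2) (a : Fin 2) => z (κ j.succ) a.succ.succ - z (κ 0) a.succ.succ) =
      Matrix.of fun j : Fin 2 => (fun (k : Fin 3) (a : Fin 2) => z k a.succ.succ) (κ j.succ) -
        (fun (k : Fin 3) (a : Fin 2) => z k a.succ.succ) (κ 0) := by
    ext j a; rfl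
  have e2 : (Matrix.of fun (j : Fin 2) (a : Fin 2) => z j.succ a.succ.succ - z 0 a.succ.succ) =
      Matrix.of fun j : Fin 2 => (fun (k : Fin 3) (a : Fin 2) => z k a.succ.succ) j.succ -
        (fun (k : Fin 3) (a : Fin 2) => z k a.succ.succ) 0 := by
    ext j a; rfl
  rw [hsum, e1, hdet, ← e2]
  ring

/-- Translating the three points by `t` changes `E₃` by `3 t₁` times the `2`-volume. [folklore] -/
theorem potential3_add_const (z : Fin 3 → Fin 4 → R) (t : Fin 4 → R) :
    𝐄₃⟦fun k a => z k a + t a⟧ = 𝐄₃⟦z⟧ + 3 * t 1 * 𝐕₂⟦z⟧ := by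
  have hsum : ∑ m : Fin 3, (z m (1 : Fin 4) + t 1) = (∑ m : Fin 3, z m 1) + 3 * t 1 := by
    rw [Finset.sum_add_distrib, Finset.sum_const, Finset.card_univ, Fintype.card_fin, nsmul_eq_mul]
    norm_num
  have hdet : (Matrix.of fun (j : Fin 2) (a : Fin 2) =>
      (z j.succ a.succ.succ + t a.succ.succ) - (z 0 a.succ.succ + t a.succ.succ)) =
      Matrix.of fun (j : Fin 2) (a : Fin 2) => z j.succ a.succ.succ - z 0 a.succ.succ := by
    ext j a; simp only [Matrix.of_apply, add_sub_add_right_eq_sub]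
  rw [hsum, hdet]
  ring

/-- `det₂` of the differences vanishes when two of the three points coincide. [folklore] -/
theorem vol2_eq_zero_of_not_injective (z : Fin 3 → Fin 4 → R) (hz : ¬ Function.Injective z) : 𝐕₂⟦z⟧ = 0 := by
  obtain ⟨p, q, hpq, hne⟩ : ∃ p q, z p = z q ∧ p ≠ q := by
    simpa [Function.Injective] using hz
  have h01 : z 0 = z 1 → 𝐕₂⟦z⟧ = 0 := fun h =>
    Matrix.det_eq_zero_of_row_eq_zero 0 fun a => by simp [Matrix.of_apply, h]
  have h02 : z 0 = z 2 → 𝐕₂⟦z⟧ = 0 := fun h =>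
    Matrix.det_eq_zero_of_row_eq_zero 1 fun a => by simp [Matrix.of_apply, h]
  have h12 : z 1 = z 2 → 𝐕₂⟦z⟧ = 0 := fun h =>
    Matrix.det_zero_of_row_eq (M := Matrix.of fun (j : Fin 2) (a : Fin 2) =>
      z (Fin.succ j) (Fin.succ (Fin.succ a)) - z 0 (Fin.succ (Fin.succ a))) (i := 0) (j := 1) (by decide)
      (by funext a; simp [Matrix.of_apply, h])
  have key : ∀ p q : Fin 3, p ≠ q → (p = 0 ∧ q = 1) ∨ (p = 1 ∧ q = 0) ∨ (p = 0 ∧ q = 2) ∨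
      (p = 2 ∧ q = 0) ∨ (p = 1 ∧ q = 2) ∨ (p = 2 ∧ q = 1) := by decide
  rcases key p q hne with ⟨rfl, rfl⟩ | ⟨rfl, rfl⟩ | ⟨rfl, rfl⟩ | ⟨rfl, rfl⟩ | ⟨rfl, rfl⟩ | ⟨rfl, rfl⟩
  · exact h01 hpq
  · exact h01 hpq.symm
  · exact h02 hpq
  · exact h02 hpq.symm
  · exact h12 hpq
  · exact h12 hpq.symm


/-! ### The level-`2` Stokes step -/

/-- **Exactness `dx₂₃ = d(x₂ dx₃)` on a `2`-simplex** (the shoelace formula): `det₂[(z_{j+1} − z_0)_{2,3}] =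
Σ_j (−1)^j E₂(z∘δ_j)`. [folklore] -/
theorem det2_sub_eq_sum_sign_potential2 (z : Fin 3 → Fin 4 → R) :
    𝐕₂⟦z⟧ = ∑ j : Fin 3, (-1) ^ (j : ℕ) * 𝐄₂⟦fun m => z (j.succAbove m)⟧ := by
  simp only [Matrix.det_fin_two, Matrix.det_fin_one, Fin.sum_univ_succ, Fin.sum_univ_zero, Matrix.of_apply,
    Fin.succAbove]
  simp
  ring

/-- `E₂` is alternating in the two points. [folklore] -/
theorem potential2_comp_perm (w : Fin 2 → Fin 4 → R) (κ : Equiv.Perm (Fin 2)) :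
    𝐄₂⟦fun m => w (κ m)⟧ = ((Equiv.Perm.sign κ : ℤˣ) : ℤ) * 𝐄₂⟦w⟧ := by
  have hsum : ∑ m : Fin 2, w (κ m) (2 : Fin 4) = ∑ m : Fin 2, w m 2 := Equiv.sum_comp κ (fun m => w m 2)
  have hdet := det_sub_perm (fun (k : Fin 2) (a : Fin 1) => w k a.succ.succ.succ) κ
  have e1 : (Matrix.of fun (j : Fin 1) (a : Fin 1) => w (κ j.succ) a.succ.succ.succ - w (κ 0) a.succ.succ.succ) =
      Matrix.of fun j : Fin 1 => (fun (k : Fin 2) (a : Fin 1) => w k a.succ.succ.succ) (κ j.succ) -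
        (fun (k : Fin 2) (a : Fin 1) => w k a.succ.succ.succ) (κ 0) := by
    ext j a; rfl
  have e2 : (Matrix.of fun (j : Fin 1) (a : Fin 1) => w j.succ a.succ.succ.succ - w 0 a.succ.succ.succ) =
      Matrix.of fun j : Fin 1 => (fun (k : Fin 2) (a : Fin 1) => w k a.succ.succ.succ) j.succ -
        (fun (k : Fin 2) (a : Fin 1) => w k a.succ.succ.succ) 0 := by
    ext j a; rfl
  rw [hsum, e1, hdet, ← e2]
  ring

/-- Translating the two points by `t` changes `E₂` by `2 t₂` times the `1`-volume. [folklore] -/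
theorem potential2_add_const (w : Fin 2 → Fin 4 → R) (t : Fin 4 → R) :
    𝐄₂⟦fun k a => w k a + t a⟧ = 𝐄₂⟦w⟧ + 2 * t 2 * 𝐕₁⟦w⟧ := by
  have hsum : ∑ m : Fin 2, (w m (2 : Fin 4) + t 2) = (∑ m : Fin 2, w m 2) + 2 * t 2 := by
    rw [Finset.sum_add_distrib, Finset.sum_const, Finset.card_univ, Fintype.card_fin, nsmul_eq_mul]
    norm_num
  have hdet : (Matrix.of fun (j : Fin 1) (a : Fin 1) =>
      (w j.succ a.succ.succ.succ + t a.succ.succ.succ) - (w 0 a.succ.succ.succ + t a.succ.succ.succ)) =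
      Matrix.of fun (j : Fin 1) (a : Fin 1) => w j.succ a.succ.succ.succ - w 0 a.succ.succ.succ := by
    ext j a; simp only [Matrix.of_apply, add_sub_add_right_eq_sub]
  rw [hsum, hdet]
  ring

/-- `E₂` vanishes when the two points coincide. [folklore] -/
theorem potential2_eq_zero_of_not_injective (w : Fin 2 → Fin 4 → R) (hw : ¬ Function.Injective w) : 𝐄₂⟦w⟧ = 0 := by
  unfold Function.Injective at hw
  push Not at hw
  obtain ⟨p, q, hpq, hne⟩ := hw
  have key : ∀ p q : Fin 2, p ≠ q → (p = 0 ∧ q = 1) ∨ (p = 1 ∧ q = 0) := by decide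
  have h01 : w 0 = w 1 → 𝐄₂⟦w⟧ = 0 := fun h => by
    rw [Matrix.det_fin_one]
    simp [Matrix.of_apply, h]
  rcases key p q hne with ⟨rfl, rfl⟩ | ⟨rfl, rfl⟩
  · exact h01 hpq
  · exact h01 hpq.symm

end Stokes3


/-! ## §2 Canonical presentations of tuples of points (choice of orbit representatives) -/

section Canonical

/-- **Orbit representatives.** For tuples `z : Fin m → ℤᵍ` of points (`m ≥ 1`) there is a CHOICE of representatives
`rep z` of the orbits under reordering and translation, constant on orbits, with a presentation
`rep z = z ∘ κ_z + t_z`; for tuples of pairwise distinct points the presentation is unique, which makes `κ`, `t`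
equivariant: `θ · κ_{z∘θ} = κ_z`, `t_{z∘θ} = t_z`, `κ_{z+s} = κ_z`, `t_{z+s} = t_z − s`; degenerate tuples have
degenerate representatives. (`Classical.epsilon`.) [folklore] -/
theorem exists_canonical_presentation (m g : ℕ) [NeZero m] :
    ∃ (rep : (Fin m → Fin g → ℤ) → (Fin m → Fin g → ℤ)) (κf : (Fin m → Fin g → ℤ) → Equiv.Perm (Fin m))
      (tf : (Fin m → Fin g → ℤ) → Fin g → ℤ),
      (∀ z j r, rep z j r = z (κf z j) r + tf z r) ∧
      (∀ (z : Fin m → Fin g → ℤ) (θ : Equiv.Perm (Fin m)), rep (fun j => z (θ j)) = rep z) ∧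
      (∀ (z : Fin m → Fin g → ℤ) (s : Fin g → ℤ), rep (fun j r => z j r + s r) = rep z) ∧
      (∀ (z : Fin m → Fin g → ℤ) (θ : Equiv.Perm (Fin m)), Function.Injective z →
        θ * κf (fun j => z (θ j)) = κf z ∧ tf (fun j => z (θ j)) = tf z) ∧
      (∀ (z : Fin m → Fin g → ℤ) (s : Fin g → ℤ), Function.Injective z →
        κf (fun j r => z j r + s r) = κf z ∧ tf (fun j r => z j r + s r) = fun r => tf z r - s r) ∧
      (∀ z : Fin m → Fin g → ℤ, ¬ Function.Injective z → ¬ Function.Injective (rep z)) := by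
  classical
  have hm : (m : ℤ) ≠ 0 := by exact_mod_cast NeZero.ne m
  -- orbits under reordering ⋉ translation
  set orb : (Fin m → Fin g → ℤ) → (Fin m → Fin g → ℤ) → Prop :=
    fun z w => ∃ κ : Equiv.Perm (Fin m), ∃ t : Fin g → ℤ, ∀ j r, w j r = z (κ j) r + t r with horb
  have orb_refl : ∀ z, orb z z := fun z => ⟨1, 0, fun j r => by simp⟩
  have orb_symm : ∀ z w, orb z w → orb w z := by
    rintro z w ⟨κ, t, h⟩
    refine ⟨κ⁻¹, fun r => -t r, fun j r => ?_⟩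
    have := h (κ⁻¹ j) r
    simp only [Equiv.Perm.coe_inv, Equiv.apply_symm_apply] at this
    rw [Equiv.Perm.coe_inv, this]; ring
  have orb_trans : ∀ z w x, orb z w → orb w x → orb z x := by
    rintro z w x ⟨κ, t, h⟩ ⟨κ', t', h'⟩
    refine ⟨κ * κ', fun r => t r + t' r, fun j r => ?_⟩
    rw [h' j r, h (κ' j) r, Equiv.Perm.mul_apply]; ring
  -- representatives (a choice, constant on orbits)
  obtain ⟨rep, hrep, rep_eq⟩ : ∃ rep : (Fin m → Fin g → ℤ) → (Fin m → Fin g → ℤ),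
      (∀ z, orb z (rep z)) ∧ (∀ z w, orb z w → rep z = rep w) := by
    refine ⟨fun z => Classical.epsilon (fun w => orb z w),
      fun z => Classical.epsilon_spec (p := fun w => orb z w) ⟨z, orb_refl z⟩, fun z w h => ?_⟩
    have e : (fun x => orb z x) = fun x => orb w x := by
      funext x
      exact propext ⟨fun hx => orb_trans w z x (orb_symm z w h) hx, fun hx => orb_trans z w x h hx⟩
    simp only [e]
  choose κf tf hκt using hrep
  -- uniqueness of the presentation for tuples of pairwise distinct points
  have uniq : ∀ z : Fin m → Fin g → ℤ, Function.Injective z →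
      ∀ (θ : Equiv.Perm (Fin m)) (s : Fin g → ℤ), (∀ j r, rep z j r = z (θ j) r + s r) → θ = κf z ∧ s = tf z := by
    intro z hz θ s h
    have hst : s = tf z := by
      funext r
      have e1 : ∑ j : Fin m, rep z j r = ∑ j : Fin m, z j r + m * s r := by
        simp_rw [h]
        rw [Finset.sum_add_distrib, Equiv.sum_comp θ (fun j => z j r), Finset.sum_const, Finset.card_univ,
          Fintype.card_fin, nsmul_eq_mul]
      have e2 : ∑ j : Fin m, rep z j r = ∑ j : Fin m, z j r + m * tf z r := by
        simp_rw [hκt z]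
        rw [Finset.sum_add_distrib, Equiv.sum_comp (κf z) (fun j => z j r), Finset.sum_const, Finset.card_univ,
          Fintype.card_fin, nsmul_eq_mul]
      have : (m : ℤ) * s r = m * tf z r := by linarith
      exact mul_left_cancel₀ hm this
    refine ⟨?_, hst⟩
    ext j : 1
    apply hz
    funext r
    have e := h j r
    rw [hκt z j r, hst] at e
    linarith
  refine ⟨rep, κf, tf, hκt, fun z θ => (rep_eq _ _ ⟨θ, 0, fun j r => by simp⟩).symm,
    fun z s => (rep_eq _ _ ⟨1, s, fun j r => by simp⟩).symm, ?_, ?_, ?_⟩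
  · intro z θ hz
    have hr : rep (fun j => z (θ j)) = rep z := (rep_eq _ _ ⟨θ, 0, fun j r => by simp⟩).symm
    have hpres : ∀ j r, rep z j r = z ((θ * κf (fun j => z (θ j))) j) r + tf (fun j => z (θ j)) r := by
      intro j r
      rw [← hr, hκt (fun j => z (θ j)) j r, Equiv.Perm.mul_apply]
    exact uniq z hz _ _ hpres
  · intro z s hz
    have hr : rep (fun j r => z j r + s r) = rep z := (rep_eq _ _ ⟨1, s, fun j r => by simp⟩).symm
    have hpres : ∀ j r, rep z j r = z (κf (fun j r => z j r + s r) j) r +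
        (fun r => tf (fun j r => z j r + s r) r + s r) r := by
      intro j r
      rw [← hr, hκt (fun j r => z j r + s r) j r]
      ring
    obtain ⟨h1, h2⟩ := uniq z hz _ _ hpres
    refine ⟨h1, ?_⟩
    funext r
    have := congrFun h2 r
    beta_reduce at this
    linarith
  · intro z hz hinj
    apply hz
    intro p q hpq
    have e : rep z ((κf z).symm p) = rep z ((κf z).symm q) := by
      funext r
      have hp := hκt z ((κf z).symm p) r
      have hq := hκt z ((κf z).symm q) r
      rw [Equiv.apply_symm_apply] at hp hq
      rw [hp, hq, hpq]
    exact (κf z).symm.injective (hinj e)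

/-- **Canonicalisation of an alternating function.** With representatives as in `exists_canonical_presentation`, an
ALTERNATING integer function `F` of `m`-tuples which vanishes on degenerate tuples has the alternating,
TRANSLATION-INVARIANT companion `F^c(z) = sign(κ_z)·F(rep z)`. [folklore] -/
theorem canonicalise {m g : ℕ} (rep : (Fin m → Fin g → ℤ) → (Fin m → Fin g → ℤ))
    (κf : (Fin m → Fin g → ℤ) → Equiv.Perm (Fin m)) (tf : (Fin m → Fin g → ℤ) → Fin g → ℤ)
    (hθ : ∀ (z : Fin m → Fin g → ℤ) (θ : Equiv.Perm (Fin m)), rep (fun j => z (θ j)) = rep z)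
    (hs : ∀ (z : Fin m → Fin g → ℤ) (s : Fin g → ℤ), rep (fun j r => z j r + s r) = rep z)
    (hκθ : ∀ (z : Fin m → Fin g → ℤ) (θ : Equiv.Perm (Fin m)), Function.Injective z →
      θ * κf (fun j => z (θ j)) = κf z ∧ tf (fun j => z (θ j)) = tf z)
    (hκs : ∀ (z : Fin m → Fin g → ℤ) (s : Fin g → ℤ), Function.Injective z →
      κf (fun j r => z j r + s r) = κf z ∧ tf (fun j r => z j r + s r) = fun r => tf z r - s r)
    (hdeg : ∀ z : Fin m → Fin g → ℤ, ¬ Function.Injective z → ¬ Function.Injective (rep z))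
    (F : (Fin m → Fin g → ℤ) → ℤ) (hFdeg : ∀ z, ¬ Function.Injective z → F z = 0) :
    (∀ (z : Fin m → Fin g → ℤ) (θ : Equiv.Perm (Fin m)),
      ((Equiv.Perm.sign (κf (fun j => z (θ j))) : ℤˣ) : ℤ) * F (rep (fun j => z (θ j))) =
        ((Equiv.Perm.sign θ : ℤˣ) : ℤ) * (((Equiv.Perm.sign (κf z) : ℤˣ) : ℤ) * F (rep z))) ∧
    (∀ (z : Fin m → Fin g → ℤ) (s : Fin g → ℤ),
      ((Equiv.Perm.sign (κf (fun j r => z j r + s r)) : ℤˣ) : ℤ) * F (rep (fun j r => z j r + s r)) =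
        ((Equiv.Perm.sign (κf z) : ℤˣ) : ℤ) * F (rep z)) := by
  constructor
  · intro z θ
    rw [hθ]
    by_cases hz : Function.Injective z
    · obtain ⟨hk, -⟩ := hκθ z θ hz
      rw [← hk, Equiv.Perm.sign_mul, Units.val_mul]
      have hs2 : ((Equiv.Perm.sign θ : ℤˣ) : ℤ) * ((Equiv.Perm.sign θ : ℤˣ) : ℤ) = 1 := by
        rw [← Units.val_mul, Int.units_mul_self, Units.val_one]
      linear_combination (-(((Equiv.Perm.sign (κf fun j => z (θ j)) : ℤˣ) : ℤ) * F (rep z))) * hs2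
    · rw [hFdeg _ (hdeg z hz), mul_zero, mul_zero, mul_zero]
  · intro z s
    rw [hs]
    by_cases hz : Function.Injective z
    · rw [(hκs z s hz).1]
    · rw [hFdeg _ (hdeg z hz), mul_zero, mul_zero]

end Canonical


end Summit.HodgeConjecture.HodgeConjecture.Theorems.TropicalWeilVanishing.Ladder

end
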